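import Mathlib
import Summits.KontsevichZagierPeriods.Zeta5Search.DenomLaw.ThresholdModelDeep

/-!
# ζ(5) search — DENOM-LAW: the threshold model in ρ-coordinates, part 3: `m = 1` admissibility (S2a) and the A1/A2 classes

Cell `pub-zeta5`, track DENOM-LAW (K1 typing order item (1), «ThresholdModel port»): denom-engine-d2 g11's kernel-checked scratch module
`denom-law/engine-d2/g11/lean/DeepCellLemmas.lean` (THRESHOLD-X3; theory-d1 g9/g10 SELECTION-LAW-PROOF Theorem S) filed VERBATIM in five parts
(≤ 400 lines each; split plan THRESHOLD-X3 §2 (a); docstrings added where the scratch file had none) by denom-prover-d1 g5.  Part 3 of 5.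
HONEST FRAMING: systematic search; MODEL/structure side — elementary integer inequalities of the level model; nothing about ζ(5); no γ; no irrationality claim; records in print UNMOVED.
The full mathematical header (setting, dictionary, what is proved) is the module docstring of part 1 (`ThresholdModelRho.lean`).
-/

namespace Summit.KontsevichZagierPeriods.Zeta5Search.DenomLaw.ThresholdModel.Rho

namespace DeepCell

variable {p R0 : ℤ} {r : Fin 7 → ℤ}

/-! ## m = 1: admissibility of every class (S2a) and the A1/A2 classes -/

/-- at most one block reaches beyond the frame on the right, and if one does then `u ≥ A`: `#{j : ρ_j ≥ 3p − u} ≤ n₊(u)`. -/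
theorem reachR_le_np (h : DeepCell p R0 r) {u : ℤ} (hc : IsClass p R0 u) : reachR p r u ≤ np p R0 u := by
  obtain ⟨_, hu2, _⟩ := hc
  have hr := h.mono
  have h56 : r 5 ≤ r 6 := h.r_le (by decide)
  have hle1 : countGe r (3 * p - u) ≤ 1 := by
    have := countGe_le hr 5 (T := 3 * p - u) (by have := h.pair_hi; omega)
    simpa using this
  unfold reachR np
  by_cases hge : 1 ≤ countGe r (3 * p - u)
  · have h6 := top_ge_of_countGe_pos hr hge
    have := h.point_hi 6
    rw [indic_pos (by omega)]
    exact hle1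
  · have := indic_nonneg (2 * p - R0 ≤ u)
    omega

/-- symmetrically on the left: `#{j : ρ_j ≥ 3p + u} ≤ n₋(u)`. -/
theorem reachL_le_nm (h : DeepCell p R0 r) {u : ℤ} (hc : IsClass p R0 u) : reachL p r u ≤ nm p R0 u := by
  obtain ⟨hu1, _, _⟩ := hc
  have hr := h.mono
  have h56 : r 5 ≤ r 6 := h.r_le (by decide)
  have hle1 : countGe r (3 * p + u) ≤ 1 := by
    have := countGe_le hr 5 (T := 3 * p + u) (by have := h.pair_hi; omega)
    simpa using this
  unfold reachL nm
  by_cases hge : 1 ≤ countGe r (3 * p + u)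
  · have h6 := top_ge_of_countGe_pos hr hge
    have := h.point_hi 6
    rw [indic_pos (by omega)]
    exact hle1
  · have := indic_nonneg (u ≤ R0 - 2 * p)
    omega

/-- A2 on the right: if `u > R₀` then all seven blocks miss the left edge, `L(u) = 7`. -/
theorem L_eq_seven_of_A2 (h : DeepCell p R0 r) {u : ℤ} (hA : R0 < u) : L p r u = 7 := by
  have hr := h.mono
  have h7 : 7 ≤ countLt r (u + p) := by
    have := countLt_ge hr 6 (T := u + p) (by have := h.point_hi 6; omega)
    simpa using this
  have := countLt_le_seven r (u + p)
  unfold L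
  omega

/-- A2 on the left: if `u < −R₀` then `R(u) = 7`. -/
theorem R_eq_seven_of_A2 (h : DeepCell p R0 r) {u : ℤ} (hA : u < -R0) : R p r u = 7 := by
  have hr := h.mono
  have h7 : 7 ≤ countLt r (p - u) := by
    have := countLt_ge hr 6 (T := p - u) (by have := h.point_hi 6; omega)
    simpa using this
  have := countLt_le_seven r (p - u)
  unfold R
  omega

/-- **EVERY m = 1 CLASS IS ADMISSIBLE (S2a)**: the four amended exponents are non-negative. -/
theorem admissible_m1 (h : DeepCell p R0 r) {u : ℤ} (hc : IsClass p R0 u) :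
    0 ≤ LA p R0 r u ∧ 0 ≤ RA p R0 r u ∧ 0 ≤ npA p R0 r u ∧ 0 ≤ nmA p R0 r u := by
  have h1 := h.reachR_le_np hc
  have h2 := h.reachL_le_nm hc
  have hL := countLt_nonneg r (u + p)
  have hR := countLt_nonneg r (p - u)
  refine ⟨?_, ?_, by unfold npA; omega, by unfold nmA; omega⟩
  · unfold LA
    by_cases hA : R0 < u
    · have := h.L_eq_seven_of_A2 hA
      rw [indic_pos hA]; omega
    · rw [indic_neg hA]; unfold L; omega
  · unfold RA
    by_cases hA : u < -R0
    · have := h.R_eq_seven_of_A2 hA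
      rw [indic_pos hA]; omega
    · rw [indic_neg hA]; unfold R; omega

/-- the amended defect never exceeds the un-amended one (so `u*` bounds both scores). -/
theorem deltaA_le_delta (p R0 : ℤ) (r : Fin 7 → ℤ) (u : ℤ) : deltaA p R0 r u ≤ delta p R0 r u := by
  have i1 := indic_nonneg (R0 < u)
  have i2 := indic_nonneg (u < -R0)
  have c1 := countGe_nonneg r (3 * p - u)
  have c2 := countGe_nonneg r (3 * p + u)
  unfold deltaA delta LA RA npA nmA reachR reachL
  omega

/-- away from A1/A2 the amendment is void: `δ_A = δ`. -/
theorem deltaA_eq_delta {u : ℤ} (hA2 : ¬ R0 < u) (hA2' : ¬ u < -R0) (hA1 : reachR p r u = 0) (hA1' : reachL p r u = 0) :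
    deltaA p R0 r u = delta p R0 r u := by
  unfold deltaA delta LA RA npA nmA
  rw [indic_neg hA2, indic_neg hA2', hA1, hA1']
  ring

/-- an **A2 class** (`|u| > R₀`) has amended defect `≥ 6`. -/
theorem six_le_deltaA_of_A2 (h : DeepCell p R0 r) {u : ℤ} (hc : IsClass p R0 u) (hA : R0 < u ∨ u < -R0) :
    6 ≤ deltaA p R0 r u := by
  obtain ⟨hLA, hRA, hnp, hnm⟩ := h.admissible_m1 hc
  have hR0 := h.R0_bounds.1
  unfold deltaA
  rcases hA with hA | hA
  · have hL := h.L_eq_seven_of_A2 hA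
    have : LA p R0 r u = 6 := by unfold LA; rw [indic_pos hA, hL]; norm_num
    omega
  · have hRR := h.R_eq_seven_of_A2 hA
    have : RA p R0 r u = 6 := by unfold RA; rw [indic_pos hA, hRR]; norm_num
    omega

/-- an **A1 class** (some block reaches beyond the frame) has amended defect `≥ 5`: the other six blocks all miss the
corresponding frame edge (pair digits: `ρ_j + ρ₇ ≤ 4p − 2`). -/
theorem five_le_deltaA_of_A1 (h : DeepCell p R0 r) {u : ℤ} (hc : IsClass p R0 u)
    (hA : 1 ≤ reachR p r u ∨ 1 ≤ reachL p r u) : 5 ≤ deltaA p R0 r u := by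
  obtain ⟨hLA, hRA, hnp, hnm⟩ := h.admissible_m1 hc
  have hr := h.mono
  have hp := h.pair_hi
  have i1 := indic_le_one (R0 < u)
  have i2 := indic_le_one (u < -R0)
  unfold deltaA
  rcases hA with hA | hA
  · have h6 := top_ge_of_countGe_pos hr (by unfold reachR at hA; exact hA)
    have hL6 : 6 ≤ countLt r (u + p) := by
      have := countLt_ge hr 5 (T := u + p) (by omega)
      simpa using this
    have : 5 ≤ LA p R0 r u := by unfold LA L; omega
    omega
  · have h6 := top_ge_of_countGe_pos hr (by unfold reachL at hA; exact hA)
    have hR6 : 6 ≤ countLt r (p - u) := by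
      have := countLt_ge hr 5 (T := p - u) (by omega)
      simpa using this
    have : 5 ≤ RA p R0 r u := by unfold RA R; omega
    omega

/-- **A1/A2 CLASSES ARE NEVER DOMINANT** (m = 1, amended score). -/
theorem not_dominantA_of_A1A2 (h : DeepCell p R0 r) {u : ℤ}
    (hA : R0 < u ∨ u < -R0 ∨ 1 ≤ reachR p r u ∨ 1 ≤ reachL p r u) : ¬ IsDominantA p R0 r u := by
  rintro ⟨hc, hmin⟩
  have h5 : 5 ≤ deltaA p R0 r u := by
    rcases hA with hA | hA | hA | hA
    · linarith [h.six_le_deltaA_of_A2 hc (Or.inl hA)]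
    · linarith [h.six_le_deltaA_of_A2 hc (Or.inr hA)]
    · exact h.five_le_deltaA_of_A1 hc (Or.inl hA)
    · exact h.five_le_deltaA_of_A1 hc (Or.inr hA)
  have h1 := hmin _ h.utStar_isClass
  have h2 := h.score_utStar_le_four
  have h3 := deltaA_le_delta p R0 r (utStar p R0 r)
  have h4 := indic_nonneg (u = 0 ∨ u = p)
  unfold scoreA score centre at *
  linarith

/-- every dominant class of the amended score (m = 1) has amended defect `≤ 4`. -/
theorem dominantA_delta_le_four (h : DeepCell p R0 r) {u : ℤ} (hd : IsDominantA p R0 r u) : deltaA p R0 r u ≤ 4 := by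
  obtain ⟨_, hmin⟩ := hd
  have h1 := hmin _ h.utStar_isClass
  have h2 := h.score_utStar_le_four
  have h3 := deltaA_le_delta p R0 r (utStar p R0 r)
  have h4 := indic_nonneg (u = 0 ∨ u = p)
  unfold scoreA score centre at *
  linarith

/-- **EVERY DOMINANT CLASS IS ADMISSIBLE (S3b, m ≥ 2)**: a class with a numerator level missing (`|u| > R₀`) or a pole
one level outside the frame (some `ρ_j ≥ 3p ∓ u`) has un-amended defect `≥ 5` and is not in the argmin. -/
theorem not_dominant_of_nonadmissible (h : DeepCell p R0 r) {u : ℤ}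
    (hA : R0 < u ∨ u < -R0 ∨ 1 ≤ reachR p r u ∨ 1 ≤ reachL p r u) : ¬ IsDominant p R0 r u := by
  rintro ⟨hc, hmin⟩
  have h5 : 5 ≤ deltaA p R0 r u := by
    rcases hA with hA | hA | hA | hA
    · linarith [h.six_le_deltaA_of_A2 hc (Or.inl hA)]
    · linarith [h.six_le_deltaA_of_A2 hc (Or.inr hA)]
    · exact h.five_le_deltaA_of_A1 hc (Or.inl hA)
    · exact h.five_le_deltaA_of_A1 hc (Or.inr hA)
  have h0 := deltaA_le_delta p R0 r u
  have h1 := hmin _ h.utStar_isClass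
  have h2 := h.score_utStar_le_four
  have h4 := indic_nonneg (u = 0 ∨ u = p)
  unfold score centre at *
  linarith

/-! ## The deep condition in its original counting form (engine-d2 g9 `exhaust.py`: `a ∈ {0,1,2}`, `λ ≤ DEEP[a]`) -/

end DeepCell

end Summit.KontsevichZagierPeriods.Zeta5Search.DenomLaw.ThresholdModel.Rho
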